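import Mathlib
import Summits.KontsevichZagierPeriods.KontsevichZagierPeriods.Theorems.SoloInformedLocSplit
import Summits.KontsevichZagierPeriods.KontsevichZagierPeriods.Theorems.SoloInformedPiSat
import HarnessLib
import HarnessLib.Audit

/-!
# SoloInformed — localisation splitting at `θ₀`: KZP ⟺ KZLocTheta ∧ PiSatTheta, unconditionally

Sequel to `Theorems/SoloInformedLocSplit.lean` (general element) and `Theorems/SoloInformedPiSat.lean`
(the one-element residual `SoloInformedPiSatTheta`: the class `⟦Ψ[h₀]⟧ = ⟦∫₀¹ 8 dt/((t−1)²+1)⟧` of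
value `2π` is a non-zero-divisor of the formal period ring `P`).  Instantiating the splitting at
that class removes the three hypotheses of `soloInformed_kzp_iff_piSatTheta` (separation of poles,
Nash cubulation, Ayoub's conjecture on symbols localised at `θ₀`) at the price of one explicit
conjunct, the period conjecture for the localised ring `P[⟦2π⟧⁻¹]`:

* `soloInformed_kzp_iff_locTheta_and_piSatTheta` :
  `KontsevichZagierPeriods ↔ SoloInformedKZLocTheta ∧ SoloInformedPiSatTheta` — NO hypotheses;
* `soloInformed_kzp_iff_piSatTheta_of_locTheta` : under `SoloInformedKZLocTheta` alone,
  KZP ⟺ `PiSatTheta`.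

`SoloInformedKZLocTheta` is the naive form of the period conjecture for Kontsevich–Zagier's
`P̂ = P[(2πi)⁻¹]` [Kontsevich–Zagier 2001, §4.1]; under the comparison `P[θ₀⁻¹] ⊗ ℚ ≅ P̃(ℚ)`
[Ayoub 2014, Def. 10, Prop. 11; Huber–Müller-Stach 2017, Def. 13.1.1, Prop. 13.2.21] it is
Grothendieck's period conjecture for all Nori motives over `ℚ`, and `PiSatTheta` is the naive form
of "`P̃^eff(ℚ) → P̃(ℚ)` is injective" [Huber–Müller-Stach 2017, Rem. 9.3.5; Huber–Wüstholz 2022,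
App. A.3; Ayoub 2019, Rem. 1.3].  The theorem is the hypothesis-free kernel form of the programme's
sharpest statement "KZP ⟺ GPC ∧ FULL^eff", the dictionary being its only non-kernel part.

References: as in `SoloInformedLocSplit.lean`.
-/

noncomputable section

open Literature.NumberTheory.Transcendental Literature.NumberTheory.Transcendental.KZ

namespace Summit.KontsevichZagierPeriods.KontsevichZagierPeriods.Theorems

/-- The class in `P` of `Ψ[h₀]`, the representation `∫₀¹ 8 dt/((t−1)²+1) = 2π` underlying Ayoub's
`θ₀` (`SoloInformedPiSat.lean`). -/
def soloInformedThetaClass : FormalPeriodRing :=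
  toFormalPeriod (soloInformedAyoubPsi soloInformed_ayoubLemmaQ (soloInformedAyoubOf soloInformedThetaIm))

/-- `evalP ⟦Ψ[h₀]⟧ = 2π`. -/
theorem soloInformed_evalP_thetaClass : evalP soloInformedThetaClass = 2 * Real.pi :=
  (soloInformed_evalP_of_ev_eq_two_pi_I soloInformedTheta₀_ev).2

/-- `evalP ⟦Ψ[h₀]⟧ ≠ 0`. -/
theorem soloInformed_evalP_thetaClass_ne_zero : evalP soloInformedThetaClass ≠ 0 := by
  rw [soloInformed_evalP_thetaClass]
  positivity

/-- `SoloInformedPiSatTheta` is literally "`⟦Ψ[h₀]⟧` cancels in `P`". -/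
theorem soloInformed_piSatTheta_iff_cancel :
    SoloInformedPiSatTheta ↔ ∀ q : FormalPeriodRing, soloInformedThetaClass * q = 0 → q = 0 :=
  Iff.rfl

/-- **The period conjecture localised at `θ₀`**: `P[⟦2π⟧⁻¹] → ℝ` is injective (formal periods with
equal values agree after multiplication by a power of `⟦2π⟧`).  A consequence of KZP
(`soloInformed_kzLocTheta_of_kzp`); OPEN. [Kontsevich–Zagier 2001, §4.1; Ayoub 2014, Conj. 7] -/
@[conjecture] def SoloInformedKZLocTheta : Prop :=
  SoloInformedKZLocAt soloInformedThetaClass soloInformed_evalP_thetaClass_ne_zero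

/-- `KZP → KZLocTheta`. -/
theorem soloInformed_kzLocTheta_of_kzp (h : KontsevichZagierPeriods) : SoloInformedKZLocTheta :=
  soloInformed_kzLocAt_of_kzp h soloInformedThetaClass soloInformed_evalP_thetaClass_ne_zero

/-- **THEOREM (unconditional splitting of the summit at `θ₀`).**
`KontsevichZagierPeriods ⟺ SoloInformedKZLocTheta ∧ SoloInformedPiSatTheta`: the Kontsevich–Zagier
period conjecture holds iff it holds after inverting `⟦2π⟧` AND `⟦2π⟧` can be cancelled modulo the
moves. -/
theorem soloInformed_kzp_iff_locTheta_and_piSatTheta :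
    KontsevichZagierPeriods ↔ SoloInformedKZLocTheta ∧ SoloInformedPiSatTheta :=
  soloInformed_kzp_iff_loc_and_cancel soloInformedThetaClass soloInformed_evalP_thetaClass_ne_zero

/-- Under the localised conjecture at `θ₀` alone, KZP ⟺ `PiSatTheta` (compare
`soloInformed_kzp_iff_piSatTheta`, which assumed separation of poles, Nash cubulation and Ayoub's
conjecture on symbols instead). -/
theorem soloInformed_kzp_iff_piSatTheta_of_locTheta (hL : SoloInformedKZLocTheta) :
    KontsevichZagierPeriods ↔ SoloInformedPiSatTheta :=
  ⟨soloInformed_piSatTheta_of_kzp,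
    fun hS => soloInformed_kzp_iff_locTheta_and_piSatTheta.2 ⟨hL, hS⟩⟩

/-- The two one-element residuals are siblings: under KZP both `⟦[π]⟧` and `⟦2π⟧ = ⟦Ψ[h₀]⟧` cancel,
and under the localised conjecture at either element each cancellation is equivalent to KZP. -/
theorem soloInformed_piSatTheta_iff_piCancellation_of_loc (hL : SoloInformedKZLocTheta)
    (hL' : SoloInformedKZLocAt (toFormalPeriod (of piRep)) soloInformed_evalP_piRep_ne_zero) :
    SoloInformedPiSatTheta ↔ PiCancellation :=
  (soloInformed_kzp_iff_piSatTheta_of_locTheta hL).symm.trans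
    (soloInformed_kzp_iff_piCancellation_of_locPi hL')

end Summit.KontsevichZagierPeriods.KontsevichZagierPeriods.Theorems
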